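import Summits.ResolutionOfSingularities.ResolutionOfSingularities.Theses.RadicialJung
import Summits.ResolutionOfSingularities.ResolutionOfSingularities.Theorems.PAlterationPalterationThesisIffSummit
import Summits.ResolutionOfSingularities.ResolutionOfSingularities.Theorems.PAlterationPicoverOfDegP
import Summits.ResolutionOfSingularities.ResolutionOfSingularities.Theorems.PAlterationPicoverDegPOfPicover
import Summits.ResolutionOfSingularities.ResolutionOfSingularities.Theorems.PAlterationPalterationThesisPerfectAssembly

/-!
# Disproof of `CleanModelsSuffice` (stmt-ResolutionOfSingularities-15883) — findings

Crux (route `RadicialJung`, rank 4): `CleanModelsSuffice := ∀ p, p.Prime → PIAlt_p → CleanModels_p →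
ResolutionInChar p`.

FINDINGS (cdisprove cycle 1, 2026-08-16; every claim below is a kernel-checked theorem of this file
unless marked COMMENT):

1. UNREFUTABLE BY DESIGN (§1). The conclusion is the summit conjunct `ResolutionInChar p`, so
   `ResolutionOfSingularities → CleanModelsSuffice` (`of_summit`) and
   `¬ CleanModelsSuffice → ¬ ResolutionOfSingularities` (`not_summit_of_not`). A counterexample to the
   crux is EXACTLY a prime `p` at which `PIAlt_p` and `CleanModels_p` hold and resolution fails
   (`not_iff`); no variety over a field is known to lack a resolution (`ledger negatives`: 0).
2. OWN CONTENT PINNED (§2). Through pAlteration's PROVED per-prime frame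
   (`palterationThesisAt_iff_resolutionInChar`) the crux is equivalent to
   `∀ p prime, PIAlt_p → CleanModels_p → PICover_p` (`iff_picover`), and it follows from the degree-`p`
   residue `∀ p prime, CleanModels_p → PicoverDegP_p` (`of_degP`, the per-prime tower
   `picoverAt_of_picoverDegPAt` inlined from `Picover.OfDegP`). So its only open content is the support
   `CleanResolves` (stmt-16286): a pointwise log-clean regular model resolves `normalizationIn W L`.
3. LOAD-BEARING HYPOTHESES (§3). Dropping `PIAlt_p` costs exactly `CleanModels_p → PIAlt_p`
   (`withoutPIAlt_iff`); dropping `CleanModels_p` leaves `PIAlt_p → PICover_p`, pAlteration's open pair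
   (`withoutCleanModels_iff`); both residual statements are again sandwiched under the summit, hence
   unrefutable. Dropping `p.Prime` is (almost) free: composite `p` is vacuous (`CharP k p` impossible),
   `CleanModels_0` holds VACUOUSLY (`cleanModelsAt_zero`: in characteristic `0` a purely inseparable
   extension has degree `1 ≠ 0`), so `WithoutPrime ↔ CleanModelsSuffice ∧ (PIAlt_0 → ResolutionInChar 0)`
   (`withoutPrime_iff`) — the residue is Hironaka-from-alterations in characteristic `0` (a regular
   purely inseparable alteration in char `0` is birational), folklore, not refutable.
4. VACUITY / JUNK AUDIT OF `CleanModels_p` AS TYPED (§4). Not junk-true and not junk-false where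
   testable: (a) the toroidal clause demands an EXACT monomial `∏ t_i^{a_i}` with no unit factor — harmless,
   units absorb because `gcd(p, a_i) = 1` (`exists_eq_pow_mul_pow`: `u = c^p · w^a` in any commutative
   group), at the price `y ↦ y / c`; (b) the regular clause (ii) `u₀ - c^p ∈ 𝔪 ∖ 𝔪²` does not depend on
   the lift `c` of the residue class (`sub_add_pow_expChar_sub_mem_sq`: `(c+δ)^p = c^p + δ^p`, `δ^p ∈ 𝔪²`), and clause (i) is VOID at
   points with perfect residue field (`exists_sub_pow_mem_maximalIdeal_of_perfect`);
   (c) COMMENT: `V = W` is NOT always a witness — `W = 𝔸²`, `p = 2`, `L = K(√(xy(x+y)))` is clean at the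
   origin for NO generator (`d g' = c₁² (y² dx + x² dy)` has an `𝔪`-primary zero of colength 4, whereas
   `d(t₁^{a₁} t₂^{a₂}) = (square unit) · d(t₁ t₂)` has colength 1 and `d(t₁^{a₁})` none), so the blow-up in
   `CleanModels_p` is load-bearing (one blow-up of the origin cleans this example: Giraud 1983);
   (d) COMMENT: generic point ⇒ regular type (i) (`g` is not a `p`-th power), codimension-1 points ⇒
   `e·f = p` (excellent DVR, defectless) ⇒ toroidal `m = 1, a = 1` or regular (i); `dim W ≤ 1` ⇒
   `CleanModels_p` holds with `V = W`.
5. MECHANISM NOTES FOR THE OPEN CONTENT `CleanResolves` (§5, COMMENT + one theorem). Local algebra is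
   sound: at a toroidal point the normalisation is `𝒪_v ⊗_{𝔽_p[ℕ^m]} 𝔽_p[Q]`, `Q = sat(ℕ^m + ℕ·a/p)`,
   free of rank `p` over `𝒪_v` on the monomials `u^{(j a mod p)}`, Kato-log-regular, the cyclic quotient
   singularity `𝔸^m/μ_p` of weights `a` times `𝔸^{d-m}`, with TRIVIAL codimension-1 stabilisers exactly
   because `p ∤ a_i`; at regular-type points it is regular (in tree:
   `Theorems.RadicialJung.CleanResolves.isRegularLocalRing_stalk_normalizationIn_of_regularType`).
   The boundary is NOT intrinsic: `xy` and `x(y + x^{p-1}) = xy + x^p` are clean toroidal presentations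
   of the same `L` at `0 ∈ 𝔸²` with different boundary divisors, and the `e = p` prime divisors of
   `L = K((y/x)^{1/p})` on `𝔸³` through the `z`-axis are ALL planes `ax + by = 0` — infinitely many — so
   no Zariski/étale log structure on `V^L` is determined by the data and Kato (10.4)/Nizioł 5.8 cannot
   be quoted globally without a boundary rider (planner's anticipated `CleanModelsR`). The ideators'
   exit `kummer-chart-bergh-rydh` (vendored `BerghRydh2019_diagonalizableQuotientResolution`, read
   against arXiv:1905.00872 Thm 5 p. 4 this session: faithful) needs `k` PERFECT; the crux's
   conclusion is over ALL fields and the tree proves the imperfect-field difficulty of the summit is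
   entirely of `PICover` type (`Theorems.resolutionOfSingularities_iff_perfect_and_descent`), so the
   IMPERFECT-FIELD instances of `CleanModels_p` and of `CleanResolves` are load-bearing for this crux:
   `of_perfect_and_descent` (§5) records the exact residual implication.

Nothing here is a refutation; nothing refutable was found. Landed separately (Negative lane):
`Theorems/CleanModelsSuffice/Negative/NotCleanModelsSufficeIff.lean` (§1–§2 in landable form).
-/

noncomputable section

set_option linter.dupNamespace false

open CategoryTheory AlgebraicGeometry TopologicalSpace
open Literature.AlgebraicGeometry.Resolution Literature.AlgebraicGeometry.Motives
open Summit.ResolutionOfSingularities.ResolutionOfSingularities.Theses.RadicialJung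
open Summit.ResolutionOfSingularities.ResolutionOfSingularities.Theorems

namespace Summit.ResolutionOfSingularities.ResolutionOfSingularities.Cruxes.CleanModelsSuffice.Disproof

/-! ## §0 The crux split into its named parts (bodies verbatim from the route file) -/

/-- `PIAlt_p`: the body of `RadicialJung.Pialt` at the prime `p` (= pAlteration's `Pialt` at `p`). -/
def PIAltAt (p : ℕ) : Prop :=
  ∀ (k : Type) [Field k] [CharP k p] (X : Scheme.{0}) (f : X ⟶ Spec (.of k)),
    IsSeparated f → LocallyOfFiniteType f → QuasiCompact f → IsIntegral X →
    ∃ (X' : Scheme.{0}) (g : X' ⟶ X), IsProper g ∧ IsIntegral X' ∧ Scheme.IsRegular X' ∧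
      Function.Surjective g.base ∧ ∃ U : X.Opens, Dense (U : Set X) ∧ IsFinite (g ∣_ U) ∧
      UniversallyInjective (g ∣_ U)

/-- `CleanModels_p`: the body of `RadicialJung.CleanModels` at the prime `p`. -/
def CleanModelsAt (p : ℕ) : Prop :=
  ∀ (k : Type) [Field k] [CharP k p] (W : Scheme.{0}) [IsIntegral W] (f : W ⟶ Spec (.of k))
    (L : Type) [Field L] [Algebra W.functionField L],
    IsSeparated f → LocallyOfFiniteType f → QuasiCompact f → Scheme.IsRegular W →
    IsPurelyInseparable W.functionField L → Module.finrank W.functionField L = p →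
    ∃ (V : Scheme.{0}) (π : V ⟶ W) (_ : IsIntegral V) (_ : IsDominant π),
      IsProper π ∧ IsBirational π ∧ Scheme.IsRegular V ∧
      (∀ v : V, (∃ (y : L) (g : W.functionField), y ∉ Set.range (algebraMap W.functionField L) ∧
        algebraMap W.functionField L g = y ^ p ∧
        ((∃ (d m : ℕ) (hmd : m ≤ d) (t : Fin d → V.presheaf.stalk v) (a : Fin m → ℕ),
            Ideal.span (Set.range t) = IsLocalRing.maximalIdeal (V.presheaf.stalk v) ∧
            ringKrullDim (V.presheaf.stalk v) = (d : WithBot ℕ∞) ∧ 0 < m ∧ (∀ i, ¬ p ∣ a i) ∧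
            RatFn.functionFieldMap π g = ∏ i : Fin m,
              (algebraMap (V.presheaf.stalk v) V.functionField (t (Fin.castLE hmd i))) ^ (a i)) ∨
         (∃ u₀ : V.presheaf.stalk v, IsUnit u₀ ∧
            RatFn.functionFieldMap π g = algebraMap (V.presheaf.stalk v) V.functionField u₀ ∧
            ((∀ c : V.presheaf.stalk v, u₀ - c ^ p ∉ IsLocalRing.maximalIdeal (V.presheaf.stalk v)) ∨
             (∃ c : V.presheaf.stalk v,
                u₀ - c ^ p ∈ IsLocalRing.maximalIdeal (V.presheaf.stalk v) ∧
                u₀ - c ^ p ∉ IsLocalRing.maximalIdeal (V.presheaf.stalk v) ^ 2))))))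

/-- `PICover_p`: pAlteration's `Picover` at the prime `p` (resolution of finite radicial covers of
regular varieties), as it appears in the proved frame `palterationThesisAt_iff_resolutionInChar`. -/
def PICoverAt (p : ℕ) : Prop :=
  ∀ (k : Type) [Field k] [CharP k p] (Y X : Scheme.{0}) (f : Y ⟶ Spec (.of k)) (g : X ⟶ Y),
    IsSeparated f → LocallyOfFiniteType f → QuasiCompact f → IsIntegral Y → Scheme.IsRegular Y →
    IsIntegral X → IsFinite g → UniversallyInjective g → Function.Surjective g.base →
    Scheme.HasResolution X

/-- `PicoverDegP_p`: the degree-`p` residue of `Picover` at the prime `p` — the normalisation of a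
regular integral separated finite-type `W/k` in a purely inseparable degree-`p` extension of `K(W)`
has a resolution. -/
def PicoverDegPAt (p : ℕ) : Prop :=
  ∀ (k : Type) [Field k] [CharP k p] (W : Scheme.{0}) [IsIntegral W] (f : W ⟶ Spec (.of k))
    (L : Type) [Field L] [Algebra W.functionField L],
    IsSeparated f → LocallyOfFiniteType f → QuasiCompact f → Scheme.IsRegular W →
    IsPurelyInseparable W.functionField L → Module.finrank W.functionField L = p →
    Scheme.HasResolution (normalizationIn W L)

/-- The crux, unfolded: definitionally `∀ p, p.Prime → PIAlt_p → CleanModels_p → ResolutionInChar p`. -/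
theorem cleanModelsSuffice_iff :
    CleanModelsSuffice ↔ ∀ p : ℕ, p.Prime → PIAltAt p → CleanModelsAt p → ResolutionInChar.{0} p :=
  Iff.rfl

/-! ## §1 Why it resists: the crux is sandwiched under the summit -/

/-- Resolution in every prime characteristic gives the crux outright (its conclusion). -/
theorem of_resolutionInChar (h : ∀ p : ℕ, p.Prime → ResolutionInChar.{0} p) : CleanModelsSuffice :=
  fun p hp _ _ => h p hp

/-- Pointwise in `p`: `ResolutionInChar p` gives the `p`-instance of the crux. -/
theorem at_of_resolutionInChar (p : ℕ) (h : ResolutionInChar.{0} p) :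
    PIAltAt p → CleanModelsAt p → ResolutionInChar.{0} p :=
  fun _ _ => h

/-- **The summit implies the crux.** -/
theorem of_summit (h : _root_.ResolutionOfSingularities) : CleanModelsSuffice :=
  of_resolutionInChar (_root_.ResolutionOfSingularities_iff.mp h)

/-- **Any refutation of the crux refutes the summit** (resolution of singularities in positive
characteristic). -/
theorem not_summit_of_not (h : ¬ CleanModelsSuffice) : ¬ _root_.ResolutionOfSingularities :=
  fun hs => h (of_summit hs)

/-- **What a counterexample must be**: a prime `p` at which purely inseparable regular alterations
exist, log-clean models exist, and resolution in characteristic `p` nevertheless fails. -/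
theorem not_iff :
    ¬ CleanModelsSuffice ↔
      ∃ p : ℕ, p.Prime ∧ PIAltAt p ∧ CleanModelsAt p ∧ ¬ ResolutionInChar.{0} p := by
  rw [cleanModelsSuffice_iff]
  push Not
  rfl

/-! ## §2 Sharpening through pAlteration's proved per-prime frame -/

/-- **The per-prime degree-`p` tower** (inlined from `Picover.OfDegP.picover_of_picoverDegP`, whose
statement quantifies over all primes at once): at a fixed prime `p`, `PicoverDegP_p → PICover_p`.
[cite: Temkin2013, Rem. 1.3.5 (ii)-(iii)] -/
theorem picoverAt_of_picoverDegPAt (p : ℕ) (hp : p.Prime) (hDegP : PicoverDegPAt p) : PICoverAt p := by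
  intro k _ _ Y X f g hsep hlft hqc hY hYreg hX hfin hui hsurj
  haveI : Fact p.Prime := ⟨hp⟩
  haveI := hsep; haveI := hlft; haveI := hqc; haveI := hY; haveI := hX; haveI := hfin; haveI := hui
  haveI : IsDominant g := ⟨hsurj.denseRange⟩
  haveI : CharP Y.functionField p := Picover.TowerTransport.charP_functionField Y f
  haveI : ExpChar Y.functionField p := ExpChar.prime hp
  haveI : IsPurelyInseparable Y.functionField (FunctionFieldOver g) :=
    Picover.FunctionFieldRadicial.stub_functionFieldRadicial X Y g
  obtain ⟨n, hn⟩ := IsPurelyInseparable.finrank_eq_pow Y.functionField (FunctionFieldOver g) p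
  have hN : Scheme.HasResolution (normalizationIn Y (FunctionFieldOver g)) :=
    Picover.OfDegP.hasResolution_normalizationIn_of_finrank_eq_pow
      (fun W _ f L _ _ hs hl hq hr hpi hd => hDegP k W f L hs hl hq hr hpi hd) Y f hYreg n
      (FunctionFieldOver g) hn
  exact Picover.OfNormalizationIn.stub_ofNormalizationIn k X Y f g
    (Picover.FunctionFieldNormalizationIn.stub_functionField_normalizationIn Y (FunctionFieldOver g)) hN

/-- `PICover_p` implies its degree-`p` residue (the normalisation map is a finite universally
injective surjection onto the regular `W`): inlined from `Picover.DegPOfPicover.picoverDegP_of_picover`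
at a fixed prime. [folklore] -/
theorem picoverDegPAt_of_picoverAt (p : ℕ) (hp : p.Prime) (hPic : PICoverAt p) : PicoverDegPAt p := by
  intro k _ _ W _ f L _ _ hsep hlft hqc hWreg hpi hdeg
  haveI := hlft
  haveI : FiniteDimensional W.functionField L := Module.finite_of_finrank_pos (hdeg ▸ hp.pos)
  haveI : CharP W.functionField p := Picover.TowerTransport.charP_functionField W f
  have hW : ∀ x : W, IsIntegrallyClosed (W.presheaf.stalk x) := fun x =>
    haveI := hWreg x
    isIntegrallyClosed_of_isRegularLocalRing (W.presheaf.stalk x)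
  have hfin : IsFinite (normalizationInι W L) := isFinite_normalizationInι W L f
  have hui : UniversallyInjective (normalizationInι W L) :=
    Picover.DegPOfPicover.universallyInjective_normalizationInι W L hp hdeg hW
  have hsurj : Function.Surjective (normalizationInι W L).base :=
    (surjective_normalizationInι W L).surj
  exact hPic k W (normalizationIn W L) f (normalizationInι W L) hsep hlft hqc inferInstance
    hWreg inferInstance hfin hui hsurj

/-- **The crux through the frame**: `CleanModelsSuffice ↔ ∀ p prime, PIAlt_p → CleanModels_p → PICover_p`
(`palterationThesisAt_iff_resolutionInChar`: `PIAlt_p ∧ PICover_p ↔ ResolutionInChar p`, proved in tree). -/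
theorem iff_picover :
    CleanModelsSuffice ↔ ∀ p : ℕ, p.Prime → PIAltAt p → CleanModelsAt p → PICoverAt p := by
  refine forall₂_congr fun p hp => ?_
  constructor
  · intro h hPI hCM
    exact ((palterationThesisAt_iff_resolutionInChar p hp).mpr (h hPI hCM)).2
  · intro h hPI hCM
    exact (palterationThesisAt_iff_resolutionInChar p hp).mp ⟨hPI, h hPI hCM⟩

/-- **The crux from its degree-`p` residue** (the planner's probe, made a theorem): if log-clean models
give `PicoverDegP_p` prime by prime, the crux holds — `PIAlt_p` is consumed by the frame only. -/
theorem of_degP (h : ∀ p : ℕ, p.Prime → CleanModelsAt p → PicoverDegPAt p) : CleanModelsSuffice :=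
  iff_picover.mpr fun p hp _ hCM => picoverAt_of_picoverDegPAt p hp (h p hp hCM)

/-- **Counterexample shape through the frame**: a prime `p` with regular p.i. alterations and clean
models at which some finite radicial cover of a regular variety has NO resolution. -/
theorem not_iff_picover :
    ¬ CleanModelsSuffice ↔
      ∃ p : ℕ, p.Prime ∧ PIAltAt p ∧ CleanModelsAt p ∧ ¬ PICoverAt p := by
  rw [iff_picover]
  push Not
  rfl

/-- … equivalently (given `PIAlt_p`, `PICover_p ↔ PicoverDegP_p`) one at which the normalisation of
some regular `W` in some degree-`p` purely inseparable `L/K(W)` has no resolution ALTHOUGH a log-clean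
regular model of `(W, L)` exists — i.e. exactly `¬ CleanResolves` at `p` with the other data standing. -/
theorem not_iff_degP :
    ¬ CleanModelsSuffice ↔
      ∃ p : ℕ, p.Prime ∧ PIAltAt p ∧ CleanModelsAt p ∧ ¬ PicoverDegPAt p := by
  rw [not_iff_picover]
  refine exists_congr fun p => ?_
  constructor
  · rintro ⟨hp, hPI, hCM, hPC⟩
    exact ⟨hp, hPI, hCM, fun h => hPC (picoverAt_of_picoverDegPAt p hp h)⟩
  · rintro ⟨hp, hPI, hCM, hD⟩
    exact ⟨hp, hPI, hCM, fun h => hD (picoverDegPAt_of_picoverAt p hp h)⟩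

/-! ## §3 Load-bearing hypotheses (mutation analysis)

Each hypothesis of the crux is dropped in turn; the residual statement is identified EXACTLY. None of
the residues is refutable (each is implied by the summit), so "load-bearing" is recorded relative to
known implications: no mechanism derives the dropped hypothesis from the others. -/

/-- The crux with `PIAlt_p` dropped. -/
def WithoutPIAlt : Prop :=
  ∀ p : ℕ, p.Prime → CleanModelsAt p → ResolutionInChar.{0} p

/-- The crux with `CleanModels_p` dropped. -/
def WithoutCleanModels : Prop :=
  ∀ p : ℕ, p.Prime → PIAltAt p → ResolutionInChar.{0} p

/-- The crux with `p.Prime` dropped. -/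
def WithoutPrime : Prop :=
  ∀ p : ℕ, PIAltAt p → CleanModelsAt p → ResolutionInChar.{0} p

/-- `PIAlt_p` from resolution in characteristic `p` (the sandwich, per prime; in tree). -/
theorem piAltAt_of_resolutionInChar (p : ℕ) (h : ResolutionInChar.{0} p) : PIAltAt p :=
  fun k _ _ X f hs hl hq hi => by
    haveI := hs; haveI := hl; haveI := hq; haveI := hi
    exact pialtAt_of_resolutionInChar h k X f

/-- **Dropping `PIAlt_p` costs exactly `CleanModels_p → PIAlt_p`** (log-clean models of degree-`p`
covers of REGULAR varieties would have to produce regular purely inseparable alterations of ALL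
varieties — no mechanism; and the residue is unrefutable, being implied by `ResolutionInChar p`). -/
theorem withoutPIAlt_iff :
    WithoutPIAlt ↔ CleanModelsSuffice ∧ ∀ p : ℕ, p.Prime → CleanModelsAt p → PIAltAt p := by
  constructor
  · intro h
    exact ⟨fun p hp _ hCM => h p hp hCM, fun p hp hCM => piAltAt_of_resolutionInChar p (h p hp hCM)⟩
  · rintro ⟨hS, hPI⟩ p hp hCM
    exact hS p hp (hPI p hp hCM) hCM

/-- **Dropping `CleanModels_p` leaves `PIAlt_p → PICover_p`**, route pAlteration's open pair (the
Abramovich–Oort alteration does not resolve radicial covers; unrefutable likewise). -/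
theorem withoutCleanModels_iff :
    WithoutCleanModels ↔ ∀ p : ℕ, p.Prime → PIAltAt p → PICoverAt p := by
  refine forall₂_congr fun p hp => ?_
  constructor
  · intro h hPI
    exact ((palterationThesisAt_iff_resolutionInChar p hp).mpr (h hPI)).2
  · intro h hPI
    exact (palterationThesisAt_iff_resolutionInChar p hp).mp ⟨hPI, h hPI⟩

/-- **`CleanModels_0` holds VACUOUSLY**: over a field of characteristic `0` the function field has
characteristic `0`, a purely inseparable `L/K(W)` is trivial, so `Module.finrank K(W) L = 1 ≠ 0` —
the degree hypothesis `= p` is unsatisfiable at `p = 0`. (Vacuity of the `p = 0` slot only; at a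
prime `p` the degree hypothesis is of course satisfiable.) [folklore] -/
theorem cleanModelsAt_zero : CleanModelsAt 0 := by
  intro k _ _ W _ f L _ _ _ _ _ _ hpi hdeg
  exfalso
  haveI : CharP W.functionField 0 := Picover.TowerTransport.charP_functionField W f
  haveI : CharZero W.functionField := CharP.charP_to_charZero W.functionField
  haveI : Algebra.IsAlgebraic W.functionField L := hpi.isAlgebraic
  have hsurj : Function.Surjective (algebraMap W.functionField L) :=
    IsPurelyInseparable.surjective_algebraMap_of_isSeparable W.functionField L
  haveI : Module.Finite W.functionField L :=
    Module.Finite.of_surjective (Algebra.linearMap W.functionField L) hsurj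
  have hpos : 0 < Module.finrank W.functionField L := Module.finrank_pos
  omega

/-- At a composite (non-prime, non-zero) `p` every slot is vacuous: no field has characteristic `p`. -/
theorem resolutionInChar_of_not_prime (p : ℕ) (hp : ¬ p.Prime) (hp0 : p ≠ 0) :
    ResolutionInChar.{0} p := by
  intro k _ _ X f _ _ _ _
  exfalso
  rcases CharP.char_is_prime_or_zero k p with h | h
  · exact hp h
  · exact hp0 h

/-- **Dropping `p.Prime` is almost free**: composite `p` is vacuous and `CleanModels_0` holds vacuously,
so the only residue is `PIAlt_0 → ResolutionInChar 0` — Hironaka from regular purely inseparable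
(= birational, in characteristic `0`) alterations, folklore and unrefutable. `p.Prime` is decoration
modulo that residue, not load-bearing. -/
theorem withoutPrime_iff :
    WithoutPrime ↔ CleanModelsSuffice ∧ (PIAltAt 0 → ResolutionInChar.{0} 0) := by
  constructor
  · intro h
    exact ⟨fun p _ hPI hCM => h p hPI hCM, fun hPI => h 0 hPI cleanModelsAt_zero⟩
  · rintro ⟨hS, h0⟩ p hPI hCM
    by_cases hp : p.Prime
    · exact hS p hp hPI hCM
    · by_cases hp0 : p = 0
      · subst hp0; exact h0 hPI
      · exact resolutionInChar_of_not_prime p hp hp0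

/-! ## §4 Vacuity / junk audit of `CleanModels_p` as typed

(a) The toroidal clause asks for an EXACT monomial `functionFieldMap π g = ∏ t_i^{a_i}` — no unit
factor. This is not stronger than "monomial times a unit": with `gcd(p, a₁) = 1` every unit `u` of the
stalk is `c^p · w^{a₁}` (next lemma, in the unit group), so `u · ∏ t_i^{a_i} = c^p · (w t₁)^{a₁} ∏_{i≥2} …`
and `g ↦ g / c^p`, `y ↦ y / c` restores the exact shape (and `(w t₁, t₂, …)` is again a minimal system
of generators). (b) The regular clause (ii) is independent of the lift of the residue `p`-th root
(`sub_add_pow_expChar_sub_mem_sq`). (c)/(d): see the module docstring (COMMENT-level). -/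

/-- **Units absorb into a prime-to-`p` exponent**: in a commutative group, if `gcd(p, a) = 1` then every
element is a `p`-th power times an `a`-th power (Bézout). Applied to the unit group of `𝒪_{V,v}` this
shows the exact-monomial typing of the toroidal clause of `CleanModels` is harmless. [folklore] -/
theorem exists_eq_pow_mul_pow {G : Type*} [CommGroup G] {p a : ℕ} (h : Nat.Coprime p a) (u : G) :
    ∃ c w : G, u = c ^ p * w ^ a := by
  obtain ⟨r, s, hrs⟩ : ∃ r s : ℤ, (r * p + s * a : ℤ) = 1 := by
    refine ⟨Nat.gcdA p a, Nat.gcdB p a, ?_⟩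
    have := Nat.gcd_eq_gcd_ab p a
    rw [Nat.Coprime] at h
    rw [h] at this
    push_cast at this
    linarith [mul_comm (p : ℤ) (Nat.gcdA p a), mul_comm (a : ℤ) (Nat.gcdB p a)]
  refine ⟨u ^ r, u ^ s, ?_⟩
  rw [← zpow_natCast, ← zpow_natCast, ← zpow_mul, ← zpow_mul, ← zpow_add]
  conv_lhs => rw [← zpow_one u]
  rw [hrs]

/-- **The regular clause (ii) does not depend on the lift**: in a commutative ring of prime
characteristic `p`, changing the lift `c` of a residue class by `δ ∈ 𝔪` changes `u₀ - c^p` by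
`δ^p ∈ 𝔪^p ⊆ 𝔪²`, so membership of `u₀ - c^p` in `𝔪 ∖ 𝔪²` is a property of the residue class of `c`
(which is unique: Frobenius is injective on the residue field). [folklore] -/
theorem sub_add_pow_expChar_sub_mem_sq {R : Type*} [CommRing R] (p : ℕ) [hp : Fact p.Prime] [CharP R p]
    (I : Ideal R) (u₀ c δ : R) (hδ : δ ∈ I) :
    (u₀ - (c + δ) ^ p) - (u₀ - c ^ p) ∈ I ^ 2 := by
  have h2 : 2 ≤ p := hp.out.two_le
  rw [add_pow_char]
  have : (u₀ - (c ^ p + δ ^ p)) - (u₀ - c ^ p) = -(δ ^ p) := by ring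
  rw [this, Ideal.neg_mem_iff]
  exact Ideal.pow_le_pow_right h2 (Ideal.pow_mem_pow hδ p)

open IsLocalRing in
/-- **Regular clause (i) is void at points with perfect residue field**: if the residue field of the
local ring `𝒪` is perfect of characteristic `p`, every `u₀ ∈ 𝒪` is a `p`-th power modulo `𝔪`, so the
alternative `∀ c, u₀ - c^p ∉ 𝔪` of the regular clause of `CleanModels` never holds there (e.g. closed
points over a perfect ground field): at such points a clean presentation is toroidal or regular (ii)
(= toroidal `m = 1` after `y ↦ y - c`). Clause (i) only ever fires at points with IMPERFECT residue
field (non-closed points, or imperfect `k`) — one more place where the imperfect residue fields of the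
crux are not decoration. [folklore] -/
theorem exists_sub_pow_mem_maximalIdeal_of_perfect {O : Type*} [CommRing O] [IsLocalRing O] (p : ℕ)
    [ExpChar (ResidueField O) p] [PerfectRing (ResidueField O) p] (u₀ : O) :
    ∃ c : O, u₀ - c ^ p ∈ maximalIdeal O := by
  obtain ⟨c, hc⟩ := residue_surjective ((frobeniusEquiv (ResidueField O) p).symm (residue O u₀))
  refine ⟨c, ?_⟩
  rw [← residue_eq_zero_iff, map_sub, map_pow, hc, ← frobenius_def, ← coe_frobeniusEquiv,
    RingEquiv.apply_symm_apply, sub_self]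

/-! ## §5 The open content `CleanResolves`: where the imperfect fields sit

COMMENT (mechanism, checked on paper this session; see module docstring item 5): local algebra at clean
points is sound; the toroidal boundary is NOT intrinsic (`xy` vs `xy + x^p` at `0 ∈ 𝔸²`; all planes
through the `z`-axis are `e = p` divisors of `K((y/x)^{1/p})` on `𝔸³`), so a GLOBAL Kato log structure
on `V^L` is not determined by the data of `CleanModels_p`. The ideators' destackification exit is
printed over PERFECT ground fields only. The two theorems below pin what that exit leaves: the crux is
its perfect-field version AND a descent residue `PIAlt_p → CleanModels_p → (resolution over perfect
fields of char p → resolution over all fields of char p)` — route Descent's `DescentPerfectToAll` at `p`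
weakened by two antecedents; the tree proves the imperfect-field difficulty of the summit is entirely of
`PICover` type (`Theorems.resolutionOfSingularities_iff_perfect_and_descent`), so the imperfect-field
instances of `CleanModels_p` / `CleanResolves` are load-bearing for THIS crux as typed. -/

/-- Resolution of all reduced separated finite-type schemes over all PERFECT fields of characteristic `p`. -/
def ResPerfectAt (p : ℕ) : Prop :=
  ∀ (k : Type) [Field k] [CharP k p] [PerfectField k] (X : Scheme.{0}) (f : X ⟶ Spec (.of k)),
    IsSeparated f → LocallyOfFiniteType f → QuasiCompact f → IsReduced X → Scheme.HasResolution X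

/-- The perfect-field version of the crux (what a perfect-field-only `CleanResolves` can give). -/
def CleanModelsSufficePerfect : Prop :=
  ∀ p : ℕ, p.Prime → PIAltAt p → CleanModelsAt p → ResPerfectAt p

/-- **The crux = its perfect-field version + a descent residue** (pure logic; names the residue). -/
theorem iff_perfect_and_descent :
    CleanModelsSuffice ↔ CleanModelsSufficePerfect ∧
      ∀ p : ℕ, p.Prime → PIAltAt p → CleanModelsAt p → (ResPerfectAt p → ResolutionInChar.{0} p) := by
  constructor
  · intro h
    exact ⟨fun p hp hPI hCM k _ _ _ X f hs hl hq hr => h p hp hPI hCM k X f hs hl hq hr,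
      fun p hp hPI hCM _ => h p hp hPI hCM⟩
  · rintro ⟨hP, hD⟩ p hp hPI hCM
    exact hD p hp hPI hCM (hP p hp hPI hCM)

/-- **What the perfect-field exit closes**: if log-clean models give the degree-`p` residue over PERFECT
fields (`CleanResolves` restricted to perfect `k`, composed with `CleanModels_p`), then the perfect-field
version of the crux holds — by the in-tree fieldwise Theorem A over perfect fields
(`PalterationThesis.PerfectTransfer.stub_perfectAssembly`), the per-field degree-`p` tower
(`Picover.OfDegP.hasResolution_normalizationIn_of_finrank_eq_pow`) and reduced → integral. Together with
`iff_perfect_and_descent`: after that exit, the crux is EXACTLY the descent residue. [folklore] -/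
theorem cleanModelsSufficePerfect_of_degP_perfect
    (h : ∀ p : ℕ, p.Prime → CleanModelsAt p → ∀ (k : Type) [Field k] [CharP k p] [PerfectField k]
      (W : Scheme.{0}) [IsIntegral W] (f : W ⟶ Spec (.of k)) (L : Type) [Field L]
      [Algebra W.functionField L], IsSeparated f → LocallyOfFiniteType f → QuasiCompact f →
      Scheme.IsRegular W → IsPurelyInseparable W.functionField L →
      Module.finrank W.functionField L = p → Scheme.HasResolution (normalizationIn W L)) :
    CleanModelsSufficePerfect := by
  intro p hp hPI hCM K _ _ _ X f hs hl hq hr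
  haveI : Fact p.Prime := ⟨hp⟩
  -- PICover over the perfect field `K`, from the degree-`p` residue over `K` by the per-field tower
  have hPC : ∀ (Y X : Scheme.{0}) (f : Y ⟶ Spec (.of K)) (g : X ⟶ Y),
      IsSeparated f → LocallyOfFiniteType f → QuasiCompact f → IsIntegral Y →
      Scheme.IsRegular Y → IsIntegral X → IsFinite g → UniversallyInjective g →
      Function.Surjective g.base → Scheme.HasResolution X := by
    intro Y X f g hsep hlft hqc hY hYreg hX hfin hui hsurj
    haveI := hsep; haveI := hlft; haveI := hqc; haveI := hY; haveI := hX; haveI := hfin; haveI := hui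
    haveI : IsDominant g := ⟨hsurj.denseRange⟩
    haveI : CharP Y.functionField p := Picover.TowerTransport.charP_functionField Y f
    haveI : ExpChar Y.functionField p := ExpChar.prime hp
    haveI : IsPurelyInseparable Y.functionField (FunctionFieldOver g) :=
      Picover.FunctionFieldRadicial.stub_functionFieldRadicial X Y g
    obtain ⟨n, hn⟩ := IsPurelyInseparable.finrank_eq_pow Y.functionField (FunctionFieldOver g) p
    have hN : Scheme.HasResolution (normalizationIn Y (FunctionFieldOver g)) :=
      Picover.OfDegP.hasResolution_normalizationIn_of_finrank_eq_pow
        (fun W _ f L _ _ hs hl hq hr hpi hd => h p hp hCM K W f L hs hl hq hr hpi hd) Y f hYreg n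
        (FunctionFieldOver g) hn
    exact Picover.OfNormalizationIn.stub_ofNormalizationIn K X Y f g
      (Picover.FunctionFieldNormalizationIn.stub_functionField_normalizationIn Y (FunctionFieldOver g))
      hN
  have hPIK : ∀ (X : Scheme.{0}) (f : X ⟶ Spec (.of K)),
      IsSeparated f → LocallyOfFiniteType f → QuasiCompact f → IsIntegral X →
      ∃ (X' : Scheme.{0}) (g : X' ⟶ X), IsProper g ∧ IsIntegral X' ∧ Scheme.IsRegular X' ∧
        Function.Surjective g.base ∧ ∃ U : X.Opens, Dense (U : Set X) ∧ IsFinite (g ∣_ U) ∧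
        UniversallyInjective (g ∣_ U) := fun X f => hPI K X f
  exact Theses.PAlteration.DescentReducedToIntegral_holds K (fun Y g h1 h2 h3 h4 => by
      haveI := h1; haveI := h2; haveI := h3; haveI := h4
      exact PalterationThesis.PerfectTransfer.stub_perfectAssembly p hp K hPIK hPC Y g) X f hs hl hq hr

end Summit.ResolutionOfSingularities.ResolutionOfSingularities.Cruxes.CleanModelsSuffice.Disproof

end
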